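import Summits.Ventures.YMGap.RobustBall.RobustStarOneSided
import HarnessLib

/-!
# Venture YMGap, track ROBUST-BALL (Y2) — crux Y2-X2 for the FULL tier-1 ball, step 3c: the far case and
# the WINDOW CONTRACTION (H1) of the perturbed star kernels with the robust array

HONEST FRAMING. WHAT THIS IS: a venture file (cell `pub-ymgap`, track Y2 ROBUST-BALL, seat ds-2):
ds-4's gauge-fixed Lemma-G comparison (`StarLemmaGWeight.oneSided`, `star_isLinkWindowContraction`) RUN
FOR THE PERTURBED TORUS SPECIFICATION `perturbedTorusSpec W β` of a member `W` of the ball, whose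
single-link Dobrushin matrix is the ROBUST one, `Cst c E x z = c · tInfluence x z + E x z` with OFF-COLUMN
entries `E` (polymers larger than a plaquette — the open part of crux Y2-X2). Mechanism: gauge average at the
centre and freezing of a star link hold for the perturbed specification (`StarGaugePerturbed`); Föllmer's
comparison with boundary (`DobrushinComparisonBoundary.abs_kernel_sub_le_of_superSolution`) is run with the
super-solution `dvec + U`, `dvec` = ds-4's explicit Lemma-G super-solution at `c`, `U` = the Neumann-iterate
super-solution (`StarNeumann.superSol`) of the in-star matrix applied to the source `E · dvec`
(`RobustStar.wone`); for boundary links off the plaquette boundary of the star only `U` is present.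
Output (the one-sided bound `oneSided_robust` is `RobustStarOneSided.lean`): `far_robust` and **(H1)** `robust_star_window`: for every `y ∉ ⋆`,
`|γ_⋆(f|ω) − γ_⋆(f|η)| ≤ (Σ_{x ∈ ⋆} Krob c E θ K s y x · δ x) · d_F(ω_y, η_y)` with the robust array
`Krob = Karr c + Uarr` of `RobustStarArray`. WHAT THIS IS NOT: no received sum (that is
`RobustStarReceivedSum`), no clustering statement, no number; strong-coupling LATTICE bookkeeping on finite
tori — nothing about the continuum or the Millennium problem.

## References
* H. Föllmer, LNM 1362 (1988) Ch. I (2.7)–(2.10); R. L. Dobrushin, S. B. Shlosman (1985).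
* The tree: `Thresholds/StarWindowBoundWeight.lean` (ds-4; followed step by step), `StarLemmaGSuperSolutionDim`,
  `Literature/Probability/LatticeModels/DobrushinComparisonBoundary.lean`.
-/

noncomputable section

open MeasureTheory Function Finset
open Literature.Probability.LatticeModels
open Literature.Probability.LatticeModels.DobrushinMetric
open Literature.MathematicalPhysics.QuantumFieldTheory hiding ZdEdge
open Literature.MathematicalPhysics.QuantumFieldTheory.Balaban1983to89.StrongCouplingTorusWindow
open Summit.Ventures.YMGap.DSWindow
open Summit.Ventures.YMGap.StarKernel
open Summit.Ventures.YMGap.StarResolventDim (Delta gaugeR)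
open Summit.Ventures.YMGap.StarLemmaGDim
open Summit.Ventures.YMGap.StarLemmaGSUN (suFrobDist_mul_mul)
open Summit.Ventures.YMGap.StarNeumann
open Summit.Ventures.YMGap.RobustBall

namespace Summit.Ventures.YMGap.RobustStar

variable {d L N : ℕ} [NeZero L]

variable {W : Perturbation d L N} {β c θ : ℝ} {E : Edge d L → Edge d L → ℝ}

/-! ### The far case: `y` off the star and off its plaquette boundary -/

/-- **Robust bound for a boundary link off the plaquette boundary of the star**: only the off-column entries
`E(·, y)` see `y`; Föllmer's comparison on the whole star with the super-solution `𝟙_y + U`,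
`U = superSol (Cst c E) ⋆ (E · y) θ (2 Msrc) K ≤ Uarr`. [folklore] -/
theorem far_robust (hd : 2 ≤ d) (hL : 3 ≤ L) (hc : 0 ≤ c) (hΔ : 0 < Delta d c)
    (hE : ∀ x z, 0 ≤ E x z) (hθ0 : 0 ≤ θ) (hθ1 : θ < 1)
    (hrow : ∀ (s : Site d L), ∀ x ∈ vertexStar s, ∑ z ∈ (vertexStar s).erase x, Cst c E x z ≤ θ)
    (hK : IsKRContraction (perturbedTorusSpec W β) suFrobDist (fun e => univ.erase e) (Cst c E)) (K : ℕ)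
    {s : Site d L} {y : Edge d L} (hy : y ∉ vertexStar s) (hyb : y ∉ starBoundary s)
    {ω η : GaugeConfig d L (SUN N)} (hωη : ∀ e, e ≠ y → ω e = η e)
    {f : GaugeConfig d L (SUN N) → ℝ} (hfm : Measurable f) {B : ℝ} (hB : ∀ U, |f U| ≤ B)
    (hfdep : DependsOn f (↑(vertexStar s) : Set (Edge d L))) {δ : Edge d L → ℝ} (hδ0 : ∀ x, 0 ≤ δ x)
    (hlip : ∀ (x : Edge d L) (σ τ : GaugeConfig d L (SUN N)), (∀ e, e ≠ x → σ e = τ e) →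
      |f σ - f τ| ≤ δ x * suFrobDist (σ x) (τ x)) :
    |∫ U, f U ∂(perturbedTorusSpec W β (vertexStar s) ω) - ∫ U, f U ∂(perturbedTorusSpec W β (vertexStar s) η)| ≤
      suFrobDist (ω y) (η y) * ∑ x ∈ vertexStar s, Uarr c E θ K s y x * δ x := by
  classical
  haveI : SecondCountableTopology (Matrix (Fin N) (Fin N) ℂ) :=
    inferInstanceAs (SecondCountableTopology (Fin N → Fin N → ℂ))
  haveI : SecondCountableTopology (SUN N) := Topology.IsEmbedding.subtypeVal.secondCountableTopology
  have hL1 : 1 < L := by omega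
  have hγ : IsSpecification (perturbedTorusSpec W β) := isSpecification_perturbedTorusSpec W β
  set U : Edge d L → ℝ := superSol (Cst c E) (vertexStar s) (fun x => E x y) θ (2 * Msrc c E s y) K with hUdef
  have hU0 : ∀ z, 0 ≤ U z := fun z =>
    superSol_nonneg (Cst_nonneg hc hE) (fun x => hE x y) hθ0 hθ1
      (mul_nonneg zero_le_two (Msrc_nonneg hd hc hΔ hE s y)) K z
  have hUoff : ∀ z, z ∉ vertexStar s → U z = 0 := fun z hz => superSol_of_not_mem _ _ _ _ _ hz
  have hEle : ∀ x ∈ vertexStar s, E x y ≤ wsrc c E s y x := fun x _ =>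
    le_add_of_nonneg_right (sum_nonneg fun z _ => mul_nonneg (hE x z) (Karr_nonneg hd hc hΔ s y z))
  have hM : ∀ x ∈ vertexStar s, E x y ≤ 2 * Msrc c E s y := fun x hx =>
    (hEle x hx).trans ((wsrc_le_Msrc hd hc hΔ hE s y hx).trans
      (by linarith [Msrc_nonneg hd hc hΔ hE s y]))
  have hM0 : 0 ≤ 2 * Msrc c E s y := mul_nonneg zero_le_two (Msrc_nonneg hd hc hΔ hE s y)
  set dd : Edge d L → ℝ := fun z => (if z = y then 1 else 0) + U z with hdd
  have hsol : ∀ x ∈ vertexStar s, ∑ z ∈ univ.erase x, Cst c E x z * dd z ≤ dd x := by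
    intro x hx
    have hxy : x ≠ y := fun h => hy (h ▸ hx)
    have hyx : y ∈ univ.erase x := mem_erase.2 ⟨hxy.symm, mem_univ _⟩
    have hsplit : ∑ z ∈ univ.erase x, Cst c E x z * dd z =
        ∑ z ∈ univ.erase x, Cst c E x z * (if z = y then 1 else 0) + ∑ z ∈ univ.erase x, Cst c E x z * U z := by
      rw [← sum_add_distrib]; exact sum_congr rfl fun z _ => by rw [hdd]; ring
    have hind : ∑ z ∈ univ.erase x, Cst c E x z * (if z = y then (1 : ℝ) else 0) = E x y := by
      rw [Finset.sum_eq_single_of_mem y hyx (fun z _ hzy => by rw [if_neg hzy, mul_zero]), if_pos rfl, mul_one]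
      simp only [Cst, tInfluence_eq_zero_of_not_mem_starBoundary hL1 hx hy hyb, mul_zero, zero_add]
    have h3 : E x y + ∑ z ∈ univ.erase x, Cst c E x z * U z ≤ U x := by
      rw [sum_erase_mul_eq_sum_star x (Cst c E x) U hUoff]
      exact superSol_isSuperSolution (Cst_nonneg hc hE) hθ0 hθ1 (hrow s) hM hM0 K hx
    have hddx : dd x = U x := by simp only [hdd, if_neg hxy, zero_add]
    rw [hsplit, hind, hddx]
    exact h3
  have hrowW : ∀ x ∈ vertexStar s, ∑ z ∈ univ.erase x, (if z ∈ vertexStar s then Cst c E x z else 0) ≤ θ := by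
    intro x hx
    calc ∑ z ∈ univ.erase x, (if z ∈ vertexStar s then Cst c E x z else 0)
        = ∑ z ∈ (vertexStar s).erase x, Cst c E x z := by
          rw [← sum_filter]
          exact sum_congr (by ext z; simp [mem_erase, and_comm]) fun _ _ => rfl
      _ ≤ θ := hrow s x hx
  have hlip' : IsLipBound suFrobDist f δ := ⟨hδ0, hlip⟩
  have key := abs_kernel_sub_le_of_superSolution hγ hK (fun p q => suFrobDist_nonneg p q)
    (fun p q => suFrobDist_le p q) (R := 2 * Real.sqrt N) (by positivity) (vertexStar s) hy hωη
    (d := dd) (fun z => add_nonneg (by split_ifs <;> norm_num) (hU0 z))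
    (by simp only [hdd, if_true]; linarith [hU0 y]) hsol hθ0 hθ1 hrowW hfm hfdep hB hlip'
  refine key.trans (mul_le_mul_of_nonneg_left (sum_le_sum fun x hx => ?_) (suFrobDist_nonneg _ _))
  have hxy : x ≠ y := fun h => hy (h ▸ hx)
  simp only [hdd, if_neg hxy, zero_add]
  refine mul_le_mul_of_nonneg_right ?_ (hδ0 x)
  -- `U ≤ Uarr`: monotonicity of the Neumann super-solution in the source
  show superSol (Cst c E) (vertexStar s) (fun x => E x y) θ (2 * Msrc c E s y) K x ≤ Uarr c E θ K s y x
  unfold Uarr superSol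
  rw [if_pos hx, if_pos hx]
  exact add_le_add (iter_mono_on (Cst_nonneg hc hE) hEle K x) le_rfl

/-! ### (H1): the window contraction of the perturbed star kernels with the robust array -/

/-- **(H1) FOR THE PERTURBED STAR KERNELS WITH THE ROBUST ARRAY `Krob = Karr c + Uarr`.** Under the
hypotheses of `oneSided_robust` (`d ≥ 2`, side `≥ 3`, `c ≥ 0` below the pole, `E ≥ 0`, in-star rows of
`Cst c E` at most `θ < 1`, and the single-link Dobrushin matrix `Cst c E` for `perturbedTorusSpec W β`), the
star windows of the perturbed specification satisfy the window contraction of the Dobrushin–Shlosman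
certificate (`DSWindowCertificate.IsWindowKRContraction`, cells = links, weight = Frobenius distance) with the
array `Krob c E θ K`: on the plaquette boundary the two robust one-sided bounds are averaged
(`(c·kside_ab + c·kside_ba)/2 ≤ Karr`, `(U^{ab} + U^{ba})/2 ≤ Uarr`); off it only the Neumann correction
appears (`far_robust`). [folklore] -/
theorem robust_star_window (hd : 2 ≤ d) (hL : 3 ≤ L) (hc : 0 ≤ c) (hΔ : 0 < Delta d c)
    (hE : ∀ x z, 0 ≤ E x z) (hθ0 : 0 ≤ θ) (hθ1 : θ < 1)
    (hrow : ∀ (s : Site d L), ∀ x ∈ vertexStar s, ∑ z ∈ (vertexStar s).erase x, Cst c E x z ≤ θ)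
    (hK : IsKRContraction (perturbedTorusSpec W β) suFrobDist (fun e => univ.erase e) (Cst c E)) (K : ℕ) :
    IsWindowKRContraction (perturbedTorusSpec W β) (id : Edge d L → Edge d L) (linkWeight suFrobDist)
      starWin starWin fun e => Krob c E θ K e.1 := by
  intro e y hy ω η hωη f δ hfm hfB hfdep hδ0 hlip
  obtain ⟨B, hB⟩ := hfB
  have hL1 : 1 < L := by omega
  set s := e.1
  change y ∉ vertexStar s at hy
  have hfdep' : DependsOn f (↑(vertexStar s) : Set (Edge d L)) := hfdep
  have hlip' : ∀ (x : Edge d L) (σ τ : GaugeConfig d L (SUN N)), (∀ e, e ≠ x → σ e = τ e) →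
      |f σ - f τ| ≤ δ x * suFrobDist (σ x) (τ x) := fun x σ τ h => hlip x σ τ h
  show |∫ U, f U ∂(perturbedTorusSpec W β (vertexStar s) ω) - ∫ U, f U ∂(perturbedTorusSpec W β (vertexStar s) η)| ≤
    (∑ x ∈ vertexStar s, Krob c E θ K s y x * δ x) * suFrobDist (ω y) (η y)
  have hKrob : ∀ x, Krob c E θ K s y x = Karr c s y x + Uarr c E θ K s y x := fun x => by
    simp only [Krob, if_neg hy]
  simp_rw [hKrob]
  have hr0 : 0 ≤ suFrobDist (ω y) (η y) := suFrobDist_nonneg _ _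
  by_cases hyb : y ∈ starBoundary s
  · obtain ⟨⟨q, hq, hyq⟩, -⟩ := mem_starBoundary.1 hyb
    obtain ⟨a, b, hab, hf2⟩ := filter_mem_vertexStar_plaqEdgesT hL1 hq
    have ha2 : a ∈ (plaqEdgesT q).filter (fun e => e ∈ vertexStar s) := by rw [hf2]; simp
    have hb2 : b ∈ (plaqEdgesT q).filter (fun e => e ∈ vertexStar s) := by rw [hf2]; simp
    obtain ⟨haq, ha⟩ := mem_filter.1 ha2
    obtain ⟨hbq, hb⟩ := mem_filter.1 hb2
    have hA := oneSided_robust hd hL hc hΔ hE hθ0 hθ1 hrow hK K hq hyq hy ha haq hb hbq hab hωη hfm hB hfdep'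
      hδ0 hlip'
    have hB' := oneSided_robust hd hL hc hΔ hE hθ0 hθ1 hrow hK K hq hyq hy hb hbq ha haq hab.symm hωη hfm hB
      hfdep' hδ0 hlip'
    -- average the two one-sided bounds and compare with the robust array
    have hpair : ∀ x ∈ vertexStar s,
        ((c * kside c s a b x + superSol (Cst c E) (vertexStar s) (wone c E s y a b) θ (2 * Msrc c E s y) K x) +
          (c * kside c s b a x + superSol (Cst c E) (vertexStar s) (wone c E s y b a) θ (2 * Msrc c E s y) K x)) / 2 ≤
          Karr c s y x + Uarr c E θ K s y x := by
      intro x hx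
      have h1 : (c * kside c s a b x + c * kside c s b a x) / 2 ≤ Karr c s y x := by
        have hKx : Karr c s y x = (c / 2) *
            ∑ q' ∈ (starPlaqs s).filter (fun q' => y ∈ plaqEdgesT q'),
              ∑ ab ∈ starPairsOf s q', kside c s ab.1 ab.2 x := by
          simp only [Karr, if_pos (And.intro hx hy)]
        rw [hKx]
        have hqmem : q ∈ (starPlaqs s).filter (fun q' => y ∈ plaqEdgesT q') := mem_filter.2 ⟨hq, hyq⟩
        have hsub : ({(a, b), (b, a)} : Finset (Edge d L × Edge d L)) ⊆ starPairsOf s q := by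
          intro p hp
          simp only [mem_insert, mem_singleton] at hp
          rcases hp with rfl | rfl
          · exact mem_starPairsOf.2 ⟨⟨haq, ha⟩, ⟨hbq, hb⟩, hab⟩
          · exact mem_starPairsOf.2 ⟨⟨hbq, hb⟩, ⟨haq, ha⟩, hab.symm⟩
        have hinner : kside c s a b x + kside c s b a x ≤ ∑ ab ∈ starPairsOf s q, kside c s ab.1 ab.2 x := by
          have hne : (a, b) ≠ (b, a) := fun h => hab (Prod.mk.inj h).1
          calc kside c s a b x + kside c s b a x
              = ∑ ab ∈ ({(a, b), (b, a)} : Finset (Edge d L × Edge d L)), kside c s ab.1 ab.2 x := by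
                rw [sum_pair hne]
            _ ≤ _ := sum_le_sum_of_subset_of_nonneg hsub fun ab _ _ => kside_nonneg hd hc hΔ s _ _ _
        have houter : ∑ ab ∈ starPairsOf s q, kside c s ab.1 ab.2 x ≤
            ∑ q' ∈ (starPlaqs s).filter (fun q' => y ∈ plaqEdgesT q'),
              ∑ ab ∈ starPairsOf s q', kside c s ab.1 ab.2 x :=
          single_le_sum (f := fun q' => ∑ ab ∈ starPairsOf s q', kside c s ab.1 ab.2 x)
            (fun q' _ => sum_nonneg fun ab _ => kside_nonneg hd hc hΔ s _ _ _) hqmem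
        nlinarith [hinner.trans houter]
      have h2 := superSol_wone_avg_le_Uarr (θ := θ) hd hc hΔ hE hq hyq hy ha haq hb hbq hab K x
      linarith
    have hsum : (∑ x ∈ vertexStar s,
        (c * kside c s a b x + superSol (Cst c E) (vertexStar s) (wone c E s y a b) θ (2 * Msrc c E s y) K x) * δ x +
        ∑ x ∈ vertexStar s,
        (c * kside c s b a x + superSol (Cst c E) (vertexStar s) (wone c E s y b a) θ (2 * Msrc c E s y) K x) * δ x)
          / 2 ≤ ∑ x ∈ vertexStar s, (Karr c s y x + Uarr c E θ K s y x) * δ x := by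
      rw [← sum_add_distrib, Finset.sum_div]
      refine sum_le_sum fun x hx => ?_
      have h := mul_le_mul_of_nonneg_right (hpair x hx) (hδ0 x)
      refine le_trans (le_of_eq ?_) h
      ring
    calc |∫ U, f U ∂(perturbedTorusSpec W β (vertexStar s) ω) - ∫ U, f U ∂(perturbedTorusSpec W β (vertexStar s) η)|
        = (|∫ U, f U ∂(perturbedTorusSpec W β (vertexStar s) ω) -
              ∫ U, f U ∂(perturbedTorusSpec W β (vertexStar s) η)| +
            |∫ U, f U ∂(perturbedTorusSpec W β (vertexStar s) ω) -
              ∫ U, f U ∂(perturbedTorusSpec W β (vertexStar s) η)|) / 2 := by ring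
      _ ≤ (suFrobDist (ω y) (η y) * ∑ x ∈ vertexStar s,
            (c * kside c s a b x + superSol (Cst c E) (vertexStar s) (wone c E s y a b) θ (2 * Msrc c E s y) K x) *
              δ x +
          suFrobDist (ω y) (η y) * ∑ x ∈ vertexStar s,
            (c * kside c s b a x + superSol (Cst c E) (vertexStar s) (wone c E s y b a) θ (2 * Msrc c E s y) K x) *
              δ x) / 2 := by gcongr
      _ = suFrobDist (ω y) (η y) * ((∑ x ∈ vertexStar s,
            (c * kside c s a b x + superSol (Cst c E) (vertexStar s) (wone c E s y a b) θ (2 * Msrc c E s y) K x) *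
              δ x +
          ∑ x ∈ vertexStar s,
            (c * kside c s b a x + superSol (Cst c E) (vertexStar s) (wone c E s y b a) θ (2 * Msrc c E s y) K x) *
              δ x) / 2) := by ring
      _ ≤ suFrobDist (ω y) (η y) * ∑ x ∈ vertexStar s, (Karr c s y x + Uarr c E θ K s y x) * δ x :=
          mul_le_mul_of_nonneg_left hsum hr0
      _ = (∑ x ∈ vertexStar s, (Karr c s y x + Uarr c E θ K s y x) * δ x) * suFrobDist (ω y) (η y) := mul_comm _ _
  · -- `y` off the plaquette boundary: only the Neumann correction
    have h := far_robust hd hL hc hΔ hE hθ0 hθ1 hrow hK K hy hyb hωη hfm hB hfdep' hδ0 hlip'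
    rw [mul_comm] at h
    refine h.trans (mul_le_mul_of_nonneg_right (sum_le_sum fun x _ => ?_) hr0)
    rw [Karr_eq_zero_of_not_mem_starBoundary hyb x, zero_add]

end Summit.Ventures.YMGap.RobustStar

end
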